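import Literature.NumberTheory.EllipticCurves.NewformRankinSelbergTraceSquarefree
import Literature.NumberTheory.Automorphic.RankinSelbergContinuationSL2
import HarnessLib

/-!
# The completed trace zeta function of a newform of squarefree level as a classical
# Rankin–Selberg `L`-function

Topic `NumberTheory/EllipticCurves`; namespace `Literature.NumberTheory.EllipticCurves.ModularForms`.
Proof file (theorems only; no definition, no named fact), sequel to
`NewformRankinSelbergTraceSquarefree` (for squarefree `N` and a newform `f ∈ S₂(Γ₀(N))`:
`rsCoeff N 2 f n = Σ_{c ∣ N, c ∣ n} (c/N)|a_{n/c}|²` and, for real `w > 2`,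
`Σ rsCoeff(n) n^{-w} = (N⁻¹Σ_{c∣N} c^{1−w}) Σ |aₘ|² m^{-w}`). Here the same dictionary is recorded
for COMPLEX `w` (`Re w > 2`) as an identity of `LSeries`, and inserted in the Rankin–Selberg
unfolding (`J₀_eq_of_one_lt_re` of `RankinSelbergContinuationSL2`, for the `SL₂(ℤ)`-trace datum of
`CuspFormRankinSelbergCoefficients`): for `Re s > 1` the completed trace zeta function
`Z_f(s) = s(s−1)∫_𝒟 G_f E₀*(·,s) dμ + ½∫_𝒟 G_f dμ` of `NewformPeterssonSizeSiegelProofs` equals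

  `s(s−1) π^{-s} Γ(s) Γ(s+1) ζ(2s) (4π/N)^{-(s+1)} · (N⁻¹ Σ_{c ∣ N} c^{-s}) · Σₙ |aₙ(f)|² n^{-(s+1)}`

(`IsNewform0.traceZeta_eq_of_squarefree`). Hence, for a newform of SQUAREFREE level (a semistable
elliptic curve), the zero-free hypothesis of `IsNewform0.petersson_lower_bound_of_zeroFree` is a
statement about the meromorphic continuation of the naive Rankin–Selberg series
`Σ |aₙ|² n^{-w}` of `f` itself times explicit non-vanishing factors (on the real segment
`σ ∈ (1/2, 1)`: `σ(σ−1) < 0`, `Γ > 0`, `ζ(2σ) ≠ 0`, `N⁻¹Σ c^{-σ} > 0`), i.e. the classical question of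
a real zero of `ζ(w−1) L(Sym² f, w−1)/ζ(2w−2)` (Rankin 1939; Shimura 1975) near `w = 2`.

* `IsNewform0.LSeries_rsCoeff_eq_of_squarefree` — the complex dictionary;
* `IsNewform0.traceZeta_eq_of_squarefree` — the displayed identity.

## References

* [Rankin1939] R. A. Rankin, Proc. Cambridge Philos. Soc. 35 (1939), 357–372, §4.
* [AtkinLehner1970] A. O. L. Atkin, J. Lehner, Math. Ann. 185 (1970), Thm. 3.
-/

noncomputable section

namespace Literature.NumberTheory.EllipticCurves.ModularForms

open Literature.NumberTheory.Automorphic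
open _root_.MeasureTheory Set Filter Complex ModularForm CongruenceSubgroup
open UpperHalfPlane hiding I
open scoped Topology MatrixGroups ModularForm

variable {N : ℕ} [NeZero N]

/-- `Σ |aₙ(f)|² n^{-w}` is `LSeries`-summable for `Re w > 2` (`f ∈ S₂(Γ₀(N))`; Rankin's range).
A private copy of `LSeriesSummable_normSq_cuspCoeff` of `CuspFormSymmSquareLSeries` (not imported
here to keep the import cone small). [cite: Rankin1939, §4] -/
private theorem lseriesSummable_normSq (f : CuspForm (Gamma0 N) 2) {w : ℂ} (hw : 2 < w.re) :
    LSeriesSummable (fun n ↦ (((‖cuspCoeff f n‖ ^ 2 : ℝ)) : ℂ)) w := by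
  rw [LSeriesSummable, ← summable_norm_iff]
  have h := summable_normSq_cuspCoeff_div_rpow f hw
  refine h.congr fun n ↦ ?_
  rw [LSeries.norm_term_eq]
  rcases eq_or_ne n 0 with rfl | hn
  · simp [Real.zero_rpow (by linarith : w.re ≠ 0)]
  · rw [if_neg hn, Complex.norm_real, Real.norm_of_nonneg (sq_nonneg _)]

/-- **The complex dictionary**: for squarefree `N`, a newform `f ∈ S₂(Γ₀(N))` and `Re w > 2`,
`Σₙ rsCoeff(n) n^{-w} = (N⁻¹ Σ_{c ∣ N} c^{1−w}) · Σₙ |aₙ(f)|² n^{-w}` as `LSeries`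
(`IsNewform0.rsCoeff_eq_sum_divisors_of_squarefree`, reindexing `n = cm`). [cite: Rankin1939, §4] -/
theorem IsNewform0.LSeries_rsCoeff_eq_of_squarefree (hN : Squarefree N) {f : CuspForm (Gamma0 N) 2}
    (hf : IsNewform0 f) {w : ℂ} (hw : 2 < w.re) :
    LSeries (fun n ↦ ((rsCoeff N 2 f n : ℝ) : ℂ)) w =
      ((N : ℂ)⁻¹ * ∑ c ∈ N.divisors, (c : ℂ) ^ (1 - w)) *
        LSeries (fun n ↦ (((‖cuspCoeff f n‖ ^ 2 : ℝ)) : ℂ)) w := by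
  have hN0 := hN.ne_zero
  have hNc : (N : ℂ) ≠ 0 := by exact_mod_cast hN0
  have hw0 : w ≠ 0 := fun h ↦ by rw [h, Complex.zero_re] at hw; linarith
  set a₂ : ℕ → ℂ := fun n ↦ (((‖cuspCoeff f n‖ ^ 2 : ℝ)) : ℂ) with ha₂
  have hsum : HasSum (fun n ↦ LSeries.term a₂ w n) (LSeries a₂ w) :=
    (lseriesSummable_normSq f hw).hasSum
  set L := LSeries a₂ w with hL
  -- each divisor `c` contributes `(c/N) c^{-w} L`
  have hc_term : ∀ c ∈ N.divisors, HasSum (fun n : ℕ ↦ LSeries.term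
      (fun n ↦ (((if c ∣ n then (c : ℝ) / N * ‖cuspCoeff f (n / c)‖ ^ 2 else 0 : ℝ)) : ℂ)) w n)
        ((c : ℂ) / N * (c : ℂ) ^ (-w) * L) := by
    intro c hc
    have hc0 : 0 < c := Nat.pos_of_mem_divisors hc
    have hcc : (c : ℂ) ≠ 0 := by exact_mod_cast hc0.ne'
    have hcw : (c : ℂ) ^ w ≠ 0 := by
      rw [Ne, Complex.cpow_eq_zero_iff]; exact fun h ↦ hcc h.1
    -- reindex `n = c m`
    have hg : (fun m : ℕ ↦ (c : ℂ) / N * (c : ℂ) ^ (-w) * LSeries.term a₂ w m) =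
        fun m : ℕ ↦ (fun n : ℕ ↦ LSeries.term
          (fun n ↦ (((if c ∣ n then (c : ℝ) / N * ‖cuspCoeff f (n / c)‖ ^ 2 else 0 : ℝ)) : ℂ)) w n)
            (c * m) := by
      funext m
      rcases eq_or_ne m 0 with rfl | hm
      · simp [LSeries.term_zero]
      · have hcm : c * m ≠ 0 := mul_ne_zero hc0.ne' hm
        beta_reduce
        rw [LSeries.term_of_ne_zero hm, LSeries.term_of_ne_zero hcm]
        simp only [Nat.dvd_mul_right, if_true, Nat.mul_div_cancel_left _ hc0, ha₂]
        push_cast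
        rw [Complex.natCast_mul_natCast_cpow, Complex.cpow_neg]
        field_simp
    have h1 : HasSum (fun m : ℕ ↦ (c : ℂ) / N * (c : ℂ) ^ (-w) * LSeries.term a₂ w m)
        ((c : ℂ) / N * (c : ℂ) ^ (-w) * L) := hsum.mul_left _
    rw [hg] at h1
    have hinj : Function.Injective (fun m : ℕ ↦ c * m) := mul_right_injective₀ hc0.ne'
    have hsupp : ∀ n ∉ Set.range (fun m : ℕ ↦ c * m), LSeries.term
        (fun n ↦ (((if c ∣ n then (c : ℝ) / N * ‖cuspCoeff f (n / c)‖ ^ 2 else 0 : ℝ)) : ℂ)) w n = 0 := by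
      intro n hn
      by_cases hcn : c ∣ n
      · obtain ⟨m, rfl⟩ := hcn; exact absurd ⟨m, rfl⟩ hn
      · rcases eq_or_ne n 0 with rfl | hn0
        · exact LSeries.term_zero _ _
        · rw [LSeries.term_of_ne_zero hn0, if_neg hcn]; simp
    exact (hinj.hasSum_iff hsupp).mp h1
  -- sum over the divisors
  have htot : HasSum (fun n ↦ LSeries.term (fun n ↦ ((rsCoeff N 2 f n : ℝ) : ℂ)) w n)
      (∑ c ∈ N.divisors, (c : ℂ) / N * (c : ℂ) ^ (-w) * L) := by
    have h := hasSum_sum hc_term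
    refine h.congr_fun fun n ↦ ?_
    rcases eq_or_ne n 0 with rfl | hn
    · simp [LSeries.term_zero]
    · rw [LSeries.term_of_ne_zero hn, hf.rsCoeff_eq_sum_divisors_of_squarefree hN n]
      push_cast
      rw [Finset.sum_div]
      refine Finset.sum_congr rfl fun c _ ↦ ?_
      rw [LSeries.term_of_ne_zero hn]
  rw [LSeries, htot.tsum_eq, Finset.mul_sum, Finset.sum_mul]
  refine Finset.sum_congr rfl fun c hc ↦ ?_
  have hcc : (c : ℂ) ≠ 0 := by exact_mod_cast (Nat.pos_of_mem_divisors hc).ne'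
  rw [Complex.cpow_sub _ _ hcc, Complex.cpow_one, Complex.cpow_neg]
  field_simp

/-- **The completed trace zeta function of a newform of squarefree level on `Re s > 1`**:
`s(s−1) ∫_𝒟 G_f E₀*(·,s) dμ + ½∫_𝒟 G_f dμ
 = s(s−1) π^{-s}Γ(s)ζ(2s) Γ(s+1)(4π/N)^{-(s+1)} · (N⁻¹Σ_{c∣N} c^{-s}) · Σₙ |aₙ(f)|² n^{-(s+1)}`
(the Rankin–Selberg unfolding `J₀_eq_of_one_lt_re` for the trace datum, in which the `V`-terms
cancel, and the dictionary `IsNewform0.LSeries_rsCoeff_eq_of_squarefree` at `w = s + 1`). By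
analytic continuation `Z_f` is thus, for squarefree `N`, the completed Rankin–Selberg `L`-function
of `f` itself up to the elementary factor `N⁻¹Σ_{c∣N} c^{-s}`, positive on the real axis.
[cite: Rankin1939, §4.4] -/
theorem IsNewform0.traceZeta_eq_of_squarefree (hN : Squarefree N) {f : CuspForm (Gamma0 N) 2}
    (hf : IsNewform0 f) {s : ℂ} (hs : 1 < s.re) :
    s * (s - 1) * (∫ w in ModularGroup.fd, (rsTrace N 2 f w : ℂ) * completedEisenstein₀ w s) +
        (((∫ w in ModularGroup.fd, rsTrace N 2 f w : ℝ)) : ℂ) / 2 =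
      s * (s - 1) * ((Real.pi : ℂ) ^ (-s) * Complex.Gamma s * riemannZeta (2 * s) *
          (Complex.Gamma (s + 1) * (((4 * Real.pi / N : ℝ)) : ℂ) ^ (-(s + 1)))) *
        (((N : ℂ)⁻¹ * ∑ c ∈ N.divisors, (c : ℂ) ^ (-s)) *
          LSeries (fun n ↦ (((‖cuspCoeff f n‖ ^ 2 : ℝ)) : ℂ)) (s + 1)) := by
  -- the datum of the trace (as in `NewformPeterssonSizeSiegelProofs`)
  have hGc : Continuous (rsTrace N 2 f) := continuous_rsTrace (ModularFormClass.continuous f)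
  have hGinv : ∀ (A : SL(2, ℤ)) (τ : ℍ), rsTrace N 2 f (A • τ) = rsTrace N 2 f τ :=
    fun A τ ↦ rsTrace_smul f A τ
  have hG0 : ∀ τ, 0 ≤ rsTrace N 2 f τ := fun τ ↦ rsTrace_nonneg _ τ
  obtain ⟨B, -, hB⟩ := exists_rsTrace_le f
  have hC : ∀ n, 0 ≤ rsCoeff N 2 f n := fun n ↦ rsCoeff_nonneg _ n
  have hC0 : rsCoeff N 2 f 0 = 0 := rsCoeff_zero f
  set a : ℝ := 4 * Real.pi / N with hadef
  have ha : 0 < a := by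
    have hN0 : (0 : ℝ) < N := Nat.cast_pos.mpr (NeZero.pos N)
    positivity
  have hexp : ∀ (n : ℕ) (y : ℝ), Real.exp (-a * n * y) = Real.exp (-(4 * Real.pi * n / N) * y) := by
    intro n y; congr 1; rw [hadef]; ring
  have hsum : ∀ y : ℝ, 0 < y → Summable fun n : ℕ ↦ rsCoeff N 2 f n * Real.exp (-a * n * y) := by
    intro y hy; simp_rw [hexp]; exact summable_rsCoeff_mul_exp f hy
  have hle : ∀ y : ℝ, 0 < y → ∑' n : ℕ, rsCoeff N 2 f n * Real.exp (-a * n * y) ≤ B * y ^ (-(2 : ℝ)) := by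
    intro y hy
    simp_rw [hexp]
    have h := tsum_rsCoeff_mul_exp_le f hB hy
    rwa [Real.rpow_neg hy.le, Real.rpow_two, ← zpow_ofNat, ← div_eq_mul_inv]
  have hm : ∀ y : ℝ, 0 < y → ∫ x in (0 : ℝ)..1, rsTrace N 2 f (pt x y) =
      y ^ (2 : ℝ) * ∑' n : ℕ, rsCoeff N 2 f n * Real.exp (-a * n * y) := by
    intro y hy
    simp_rw [hexp]
    have hpt : ∀ x : ℝ, pt x y = ofComplex ((x : ℂ) + y * Complex.I) := by
      intro x; rw [pt, Complex.mk_eq_add_mul_I]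
    simp_rw [hpt]
    rw [intervalIntegral_rsTrace_horizontal f hy, Real.rpow_two, ← zpow_ofNat]
  have hκ : (0 : ℝ) ≤ 2 := by norm_num
  have hJ := J₀_eq_of_one_lt_re hGc hGinv hG0 hB hC hC0 ha hκ hsum hle hm hs
  have e : s + ((2 : ℝ) : ℂ) - 1 = s + 1 := by push_cast; ring
  rw [e, integral_complex_ofReal] at hJ
  have hs0 : s ≠ 0 := fun h ↦ by rw [h, Complex.zero_re] at hs; linarith
  have hs1 : (1 : ℂ) - s ≠ 0 := by
    intro h
    have : s = 1 := by linear_combination -h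
    rw [this, Complex.one_re] at hs
    exact lt_irrefl _ hs
  set V : ℝ := ∫ w in ModularGroup.fd, rsTrace N 2 f w with hV
  set P : ℂ := (Real.pi : ℂ) ^ (-s) * Complex.Gamma s * riemannZeta (2 * s) with hP
  set D : ℂ := LSeries (fun n ↦ ((rsCoeff N 2 f n : ℝ) : ℂ)) (s + 1) with hD
  have hscal : s * (s - 1) * (1 / (2 * s) + 1 / (2 * (1 - s))) + 1 / 2 = 0 := by
    field_simp
    ring
  calc s * (s - 1) * (∫ w in ModularGroup.fd, (rsTrace N 2 f w : ℂ) * completedEisenstein₀ w s) + (V : ℂ) / 2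
      = s * (s - 1) * (P * (Complex.Gamma (s + 1) * (a : ℂ) ^ (-(s + 1)) * D)) +
          (s * (s - 1) * (1 / (2 * s) + 1 / (2 * (1 - s))) + 1 / 2) * (V : ℂ) := by
        rw [hJ]; ring
    _ = s * (s - 1) * (P * (Complex.Gamma (s + 1) * (a : ℂ) ^ (-(s + 1)) * D)) := by
        rw [hscal, zero_mul, add_zero]
    _ = _ := by
        rw [hD, hf.LSeries_rsCoeff_eq_of_squarefree hN (by simp; linarith : 2 < (s + 1).re),
          show (1 : ℂ) - (s + 1) = -s by ring]
        ring

end Literature.NumberTheory.EllipticCurves.ModularForms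

end
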